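import Literature.Geometry.Riemannian.BakryEmerySpectralGap
import Literature.Geometry.Lorentzian.CoordScalarGradientEvolution
import HarnessLib

/-!
# The Hessian controls `g⁻¹(dη, d|∇u|²)` through the `Γ₂`-slack
# (support item `EntropyRung.BakryEmeryLogSobolev`, stmt-SmoothPoincare4-16587)

First-order (Gaffney) cut-offs `η` on a complete manifold only come with a bound on `|∇η|`, so every
integration by parts of the Bakry–Émery programme on a complete NON-compact weighted manifold
`(M, g, e^{-V} dV_g)` produces error terms `g⁻¹(dη, d|∇u|²)`, which involve the Hessian of `u`. They
are absorbed into the Hessian term of the weighted Bochner formula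
`½ L|∇u|² = |Hess u|² + g⁻¹(du, d(Lu)) + (Ric + Hess V)(∇u, ∇u)` (`L = Δ_g − g⁻¹(dV, d·)`), which the
tree's `weightedBochner_pointwise_ge` drops. This file supplies the two pointwise facts needed:

* `sq_apply_le_normSqAt_mul_mul` — Cauchy–Schwarz for a symmetric form at a positive definite point,
  off-diagonal version: `H(v, w)² ≤ |H|²_G G(v,v) G(w,w)`;
* `innerDual_gradSq_sq_le_slack` — **`g⁻¹(dη, d|∇u|²)² ≤ 4 |∇η|² |∇u|² S`**, where
  `S = ½ L|∇u|² − g⁻¹(du, d(Lu)) − K|∇u|² (≥ |Hess u|² ≥ 0)` is the slack of the pointwise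
  `Γ₂ ≥ K Γ` inequality under `Ric + Hess V ≥ K g` (read in the chart at the point:
  `∂_Y|∇u|² = 2 Hess u(Y, ∇u)`, `IsMetricOn.fderiv_gradSqAt`, the weighted Bochner formula
  `IsMetricOn.weightedLapAt_gradSqAt`, and the Cauchy–Schwarz inequality above).

Everything is proved; no definitions, no named facts.

## References

* D. Bakry, I. Gentil, M. Ledoux, *Analysis and Geometry of Markov Diffusion Operators* (2014),
  §3.2 (pp. 141–147: integrations by parts on a complete manifold with the cut-offs `ζ_k`) and
  §C.6 (`Γ₂(f) = |∇∇f|² + (Ric + ∇∇W)(∇f, ∇f)`). [BakryGentilLedoux2014]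
* J. A. Carrillo, L. Ni, Comm. Anal. Geom. 17 (2009), §3 (p. 8, the Bochner type formula) and §4
  (cut-off justification). [CarrilloNi2009]
-/

noncomputable section

set_option linter.dupNamespace false

open Bundle Set Function Module Filter Manifold
open scoped ContDiff Topology Manifold

/-! ### Cauchy–Schwarz for a symmetric form, off-diagonal -/

namespace Literature.Geometry.Lorentzian.MetricCoord.IsMetricOn

variable {E : Type*} [NormedAddCommGroup E] [NormedSpace ℝ E] [FiniteDimensional ℝ E]
  {G : E → E →L[ℝ] E →L[ℝ] ℝ} {V : Set E} {x : E}

/-- **Cauchy–Schwarz for a symmetric form at a positive definite point, off-diagonal version**: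
`H(v, w)² ≤ |H|²_G · G(v, v) · G(w, w)` (in an orthonormal basis `H(v,w) = Σ H_{km} v_k w_m`,
`|H|² = Σ H_{km}²`, `G(v,v) G(w,w) = Σ_{km} v_k² w_m²`). The diagonal case is
`abs_apply_apply_le_sqrt_normSqAt_mul`. [folklore] -/
theorem sq_apply_le_normSqAt_mul_mul (hG : IsMetricOn G V) (hx : x ∈ V)
    (hpos : ∀ v : E, v ≠ 0 → 0 < G x v v) {H : E →L[ℝ] E →L[ℝ] ℝ} (hH : ∀ v w, H v w = H w v)
    (v w : E) : H v w ^ 2 ≤ normSqAt G x H * G x v v * G x w w := by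
  classical
  have hs := hG.symm x hx
  obtain ⟨e, he⟩ := exists_orthonormal_basis hs hpos
  -- components
  set c : Fin (finrank ℝ E) → ℝ := fun k ↦ G x v (e k) with hc
  set d : Fin (finrank ℝ E) → ℝ := fun k ↦ G x w (e k) with hd
  have hv : ∑ k, c k • e k = v := sum_apply_smul_of_orthonormal e he v
  have hw : ∑ k, d k • e k = w := sum_apply_smul_of_orthonormal e he w
  have hGvv : G x v v = ∑ k, c k ^ 2 := by
    rw [apply_eq_sum_of_orthonormal e he hs v v]
    exact Finset.sum_congr rfl fun k _ ↦ by rw [hc, sq]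
  have hGww : G x w w = ∑ k, d k ^ 2 := by
    rw [apply_eq_sum_of_orthonormal e he hs w w]
    exact Finset.sum_congr rfl fun k _ ↦ by rw [hd, sq]
  have hright : ∀ u, H u w = ∑ m, d m * H u (e m) := fun u ↦ by
    conv_lhs => rw [← hw]
    rw [map_sum]
    exact Finset.sum_congr rfl fun m _ ↦ by rw [map_smul, smul_eq_mul]
  have hleft : ∀ u, H v u = ∑ k, c k * H (e k) u := fun u ↦ by
    rw [hH v u]
    conv_lhs => rw [← hv]
    rw [map_sum]
    refine Finset.sum_congr rfl fun k _ ↦ ?_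
    rw [map_smul, smul_eq_mul, hH u (e k)]
  have hHvw : H v w = ∑ k, ∑ m, c k * d m * H (e k) (e m) := by
    rw [hleft w]
    refine Finset.sum_congr rfl fun k _ ↦ ?_
    rw [hright (e k), Finset.mul_sum]
    exact Finset.sum_congr rfl fun m _ ↦ by ring
  have hnorm : normSqAt G x H = ∑ k, ∑ m, H (e k) (e m) ^ 2 :=
    hG.normSqAt_eq_sum_sq_of_orthonormal hx e he hH
  -- Cauchy–Schwarz over the product index
  have hCS : (∑ k, ∑ m, c k * d m * H (e k) (e m)) ^ 2 ≤
      (∑ k, ∑ m, (c k * d m) ^ 2) * ∑ k, ∑ m, H (e k) (e m) ^ 2 := by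
    have h := sq_sum_mul_le (ι := Fin (finrank ℝ E) × Fin (finrank ℝ E))
      (fun p ↦ c p.1 * d p.2) (fun p ↦ H (e p.1) (e p.2))
    simpa only [Fintype.sum_prod_type] using h
  have hcd : ∑ k, ∑ m, (c k * d m) ^ 2 = (∑ k, c k ^ 2) * ∑ m, d m ^ 2 := by
    rw [Finset.sum_mul_sum]
    exact Finset.sum_congr rfl fun k _ ↦ Finset.sum_congr rfl fun m _ ↦ by ring
  rw [hHvw, hnorm, hGvv, hGww]
  rw [hcd] at hCS
  calc (∑ k, ∑ m, c k * d m * H (e k) (e m)) ^ 2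
      ≤ ((∑ k, c k ^ 2) * ∑ m, d m ^ 2) * ∑ k, ∑ m, H (e k) (e m) ^ 2 := hCS
    _ = (∑ k, ∑ m, H (e k) (e m) ^ 2) * (∑ k, c k ^ 2) * ∑ m, d m ^ 2 := by ring

end Literature.Geometry.Lorentzian.MetricCoord.IsMetricOn

/-! ### The slack of `Γ₂ ≥ KΓ` dominates the Hessian: `g⁻¹(dη, d|∇u|²)² ≤ 4|∇η|²|∇u|² S` -/

namespace Summit.SmoothPoincare4.SmoothPoincare4.Theorems.BakryEmeryComplete

open Literature.Geometry.Lorentzian Literature.Geometry.Lorentzian.PseudoRiemannianMetric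
  Literature.Geometry.Riemannian

variable {E : Type*} [NormedAddCommGroup E] [NormedSpace ℝ E] [FiniteDimensional ℝ E]
  {H : Type*} [TopologicalSpace H] {I : ModelWithCorners ℝ E H} [I.Boundaryless]
  {M : Type*} [TopologicalSpace M] [ChartedSpace H M] [IsManifold I ∞ M]
  (g : PseudoRiemannianMetric I ∞ E (TangentSpace I : M → Type _)) [g.HasLeviCivita]

/-- **The Hessian error term is controlled by the `Γ₂`-slack.** Let `g` be Riemannian with
`Ric + Hess V ≥ K g` (`V ∈ C^∞`), `u, η ∈ C^∞(M)`, `L = Δ_g − g⁻¹(dV, d·)`, and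
`S(x) = ½ L|∇u|²(x) − g⁻¹(du, d(Lu))(x) − K |∇u|²(x)` the slack of the pointwise inequality
`Γ₂(u) ≥ K Γ(u)` (`weightedBochner_pointwise_ge`). Then at every `x`

  `g⁻¹(dη, d|∇u|²)(x)² ≤ 4 |∇η|²(x) |∇u|²(x) S(x)`.

Proof, in the chart at `x`: `g⁻¹(dη, d|∇u|²) = 2 Hess u(∇η, ∇u)` (`IsMetricOn.fderiv_gradSqAt`),
`Hess u(∇η, ∇u)² ≤ |Hess u|² |∇η|² |∇u|²` (`sq_apply_le_normSqAt_mul_mul`), and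
`|Hess u|² = ½L|∇u|² − g⁻¹(du, d(Lu)) − (Ric + Hess V)(∇u, ∇u) ≤ S` by the weighted Bochner
formula `IsMetricOn.weightedLapAt_gradSqAt` and `(Ric + Hess V)(∇u,∇u) ≥ K|∇u|²`. This is what
lets first-order (Gaffney) cut-offs run the Bakry–Émery integrations by parts on a complete
manifold. [cite: BakryGentilLedoux2014, §3.2 (pp. 141–147) and §C.6]
[cite: CarrilloNi2009, §3 (p. 8)] -/
theorem innerDual_gradSq_sq_le_slack (hR : g.IsRiemannian) {V : M → ℝ} {K : ℝ}
    (hV : ContMDiff I 𝓘(ℝ, ℝ) ∞ V)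
    (hRic : ∀ (y : M) (X : TangentSpace I y), K * g.val y X X ≤ g.ricci y X X + g.hessian V y X X)
    {u : M → ℝ} (hu : ContMDiff I 𝓘(ℝ, ℝ) ∞ u) {η : M → ℝ} (hη : ContMDiff I 𝓘(ℝ, ℝ) ∞ η)
    (x : M) :
    (g.innerDual x (mvfderiv I η x).toLinearMap (mvfderiv I (g.gradSq u) x).toLinearMap) ^ 2 ≤
      4 * g.gradSq η x * g.gradSq u x *
        ((1 / 2) * (g.dalembertian (g.gradSq u) x
            - g.innerDual x (mvfderiv I V x).toLinearMap (mvfderiv I (g.gradSq u) x).toLinearMap)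
          - g.innerDual x (mvfderiv I u x).toLinearMap
              (mvfderiv I (fun y ↦ g.dalembertian u y
                - g.innerDual y (mvfderiv I V y).toLinearMap
                    (mvfderiv I u y).toLinearMap) x).toLinearMap
          - K * g.gradSq u x) := by
  -- the chart at `x`, components and representatives
  set G := chartRep I (fun _ ↦ g) x 0 with hGdef
  have hGm : MetricCoord.IsMetricOn G (extChartAt I x).target :=
    OpensChart.isMetricOn_repr (val_chartPullback_eq_chartRep (fun _ : ℝ ↦ g) x 0)
  set uh : E → ℝ := u ∘ (extChartAt I x).symm with huhdef
  set Vh : E → ℝ := V ∘ (extChartAt I x).symm with hVhdef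
  set ηh : E → ℝ := η ∘ (extChartAt I x).symm with hηhdef
  have hu0 : extChartAt I x x ∈ (extChartAt I x).target := mem_extChartAt_target x
  set u₀ : chartTarget I x := ⟨extChartAt I x x, hu0⟩ with hu₀def
  have hΦu₀ : chartInv I x u₀ = x := extChartAt_to_inv x
  have huh : ContDiffOn ℝ ∞ uh (extChartAt I x).target := by
    rw [huhdef, ← contMDiffOn_iff_contDiffOn]
    exact hu.comp_contMDiffOn (contMDiffOn_extChartAt_symm x)
  have hVh : ContDiffOn ℝ ∞ Vh (extChartAt I x).target := by
    rw [hVhdef, ← contMDiffOn_iff_contDiffOn]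
    exact hV.comp_contMDiffOn (contMDiffOn_extChartAt_symm x)
  -- the coordinate weighted Bochner formula at `φ x`
  have key := hGm.weightedLapAt_gradSqAt hu0 huh hVh
  -- regularity of the manifold-level functions
  have hud : ∀ y, MDifferentiableAt I 𝓘(ℝ, ℝ) u y := fun y ↦ hu.mdifferentiableAt (by simp)
  have hVd : ∀ y, MDifferentiableAt I 𝓘(ℝ, ℝ) V y := fun y ↦ hV.mdifferentiableAt (by simp)
  have hηd : ∀ y, MDifferentiableAt I 𝓘(ℝ, ℝ) η y := fun y ↦ hη.mdifferentiableAt (by simp)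
  have hQ : ContMDiff I 𝓘(ℝ, ℝ) ∞ (g.gradSq u) := contMDiff_gradSq g hu
  have hQd : ∀ y, MDifferentiableAt I 𝓘(ℝ, ℝ) (g.gradSq u) y := fun y ↦ hQ.mdifferentiableAt (by simp)
  have hQ2 : ContMDiffAt I 𝓘(ℝ, ℝ) 2 (g.gradSq u) (chartInv I x u₀) :=
    (hQ.of_le (WithTop.coe_le_coe.mpr le_top)).contMDiffAt
  have hLs : ContMDiff I 𝓘(ℝ, ℝ) ∞ (fun y ↦ g.dalembertian u y
      - g.innerDual y (mvfderiv I V y).toLinearMap (mvfderiv I u y).toLinearMap) :=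
    (contMDiff_dalembertian g hu).sub (contMDiff_innerDual g hV hu)
  have hLd : ∀ y, MDifferentiableAt I 𝓘(ℝ, ℝ) (fun y ↦ g.dalembertian u y
      - g.innerDual y (mvfderiv I V y).toLinearMap (mvfderiv I u y).toLinearMap) y := fun y ↦
    hLs.mdifferentiableAt (by simp)
  -- (a) `|∇u|²` read in the chart (as a function near `φ x`) and `|∇u|²(x)`, `|∇η|²(x)`
  have hQrep : (g.gradSq u ∘ (extChartAt I x).symm) =ᶠ[𝓝 (extChartAt I x x)]
      MetricCoord.gradSqAt G uh := by
    filter_upwards [(isOpen_extChartAt_target x).mem_nhds hu0] with z hz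
    exact gradSq_chartInv_eq g x ⟨z, hz⟩ (hud _)
  have hgrad : g.gradSq u x = MetricCoord.gradSqAt G uh (extChartAt I x x) := by
    have h := gradSq_chartInv_eq g x u₀ (F := u) (hud _)
    rw [hΦu₀] at h
    exact h
  have hgradη : g.gradSq η x = MetricCoord.gradSqAt G ηh (extChartAt I x x) := by
    have h := gradSq_chartInv_eq g x u₀ (F := η) (hηd _)
    rw [hΦu₀] at h
    exact h
  -- (b) `Δ|∇u|²` and `g⁻¹(dV, d|∇u|²)`, `g⁻¹(dη, d|∇u|²)`
  have hlap : g.dalembertian (g.gradSq u) x =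
      MetricCoord.lapAt G (MetricCoord.gradSqAt G uh) (extChartAt I x x) := by
    have h := dalembertian_chartInv_eq g x u₀ hQ2
    rw [hΦu₀] at h
    rw [h]
    exact MetricCoord.lapAt_congr_of_eventuallyEq G hQrep
  have hIV : g.innerDual x (mvfderiv I V x).toLinearMap (mvfderiv I (g.gradSq u) x).toLinearMap =
      fderiv ℝ (MetricCoord.gradSqAt G uh) (extChartAt I x x)
        (MetricCoord.sharpAt G (extChartAt I x x) (fderiv ℝ Vh (extChartAt I x x))) := by
    have h := innerDual_chartInv_eq g x u₀ (hVd _) (hQd _)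
    rw [hΦu₀] at h
    rw [show (mvfderiv I V x).toLinearMap = (mvfderiv I V x : TangentSpace I x →ₗ[ℝ] ℝ) from rfl,
      show (mvfderiv I (g.gradSq u) x).toLinearMap =
        (mvfderiv I (g.gradSq u) x : TangentSpace I x →ₗ[ℝ] ℝ) from rfl, h,
      MetricCoord.apply_sharpAt_comm (hGm.isInvertible _ hu0) (hGm.symm _ hu0), hQrep.fderiv_eq]
  have hIη : g.innerDual x (mvfderiv I η x).toLinearMap (mvfderiv I (g.gradSq u) x).toLinearMap =
      fderiv ℝ (MetricCoord.gradSqAt G uh) (extChartAt I x x)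
        (MetricCoord.sharpAt G (extChartAt I x x) (fderiv ℝ ηh (extChartAt I x x))) := by
    have h := innerDual_chartInv_eq g x u₀ (hηd _) (hQd _)
    rw [hΦu₀] at h
    rw [show (mvfderiv I η x).toLinearMap = (mvfderiv I η x : TangentSpace I x →ₗ[ℝ] ℝ) from rfl,
      show (mvfderiv I (g.gradSq u) x).toLinearMap =
        (mvfderiv I (g.gradSq u) x : TangentSpace I x →ₗ[ℝ] ℝ) from rfl, h,
      MetricCoord.apply_sharpAt_comm (hGm.isInvertible _ hu0) (hGm.symm _ hu0), hQrep.fderiv_eq]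
  -- (c) `g⁻¹(du, d(Lu))`: the representative of `Lu` near `φ x`
  have hLrep : ((fun y ↦ g.dalembertian u y
      - g.innerDual y (mvfderiv I V y).toLinearMap (mvfderiv I u y).toLinearMap) ∘
        (extChartAt I x).symm) =ᶠ[𝓝 (extChartAt I x x)]
      fun z ↦ MetricCoord.lapAt G uh z
        - fderiv ℝ uh z (MetricCoord.sharpAt G z (fderiv ℝ Vh z)) := by
    filter_upwards [(isOpen_extChartAt_target x).mem_nhds hu0] with z hz
    have hu2 : ContMDiffAt I 𝓘(ℝ, ℝ) 2 u (chartInv I x ⟨z, hz⟩) :=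
      (hu.of_le (WithTop.coe_le_coe.mpr le_top)).contMDiffAt
    have h1 := dalembertian_chartInv_eq g x ⟨z, hz⟩ hu2
    have h2 := innerDual_chartInv_eq g x ⟨z, hz⟩ (hVd _) (hud _)
    simp only [chartInv_apply, Subtype.coe_mk] at h1 h2
    simp only [Function.comp_apply]
    rw [h1, show (mvfderiv I V ((extChartAt I x).symm z)).toLinearMap =
        (mvfderiv I V ((extChartAt I x).symm z) : TangentSpace I _ →ₗ[ℝ] ℝ) from rfl,
      show (mvfderiv I u ((extChartAt I x).symm z)).toLinearMap =
        (mvfderiv I u ((extChartAt I x).symm z) : TangentSpace I _ →ₗ[ℝ] ℝ) from rfl, h2,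
      MetricCoord.apply_sharpAt_comm (hGm.isInvertible z hz) (hGm.symm z hz)]
  have hIL : g.innerDual x (mvfderiv I u x).toLinearMap
      (mvfderiv I (fun y ↦ g.dalembertian u y
        - g.innerDual y (mvfderiv I V y).toLinearMap (mvfderiv I u y).toLinearMap) x).toLinearMap =
      fderiv ℝ (MetricCoord.lapAt G uh) (extChartAt I x x)
          (MetricCoord.sharpAt G (extChartAt I x x) (fderiv ℝ uh (extChartAt I x x)))
        - fderiv ℝ (fun y ↦ fderiv ℝ uh y (MetricCoord.sharpAt G y (fderiv ℝ Vh y)))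
          (extChartAt I x x)
          (MetricCoord.sharpAt G (extChartAt I x x) (fderiv ℝ uh (extChartAt I x x))) := by
    have h := innerDual_chartInv_eq g x u₀ (hud _) (hLd _)
    rw [hΦu₀] at h
    rw [show (mvfderiv I u x).toLinearMap = (mvfderiv I u x : TangentSpace I x →ₗ[ℝ] ℝ) from rfl,
      show (mvfderiv I (fun y ↦ g.dalembertian u y
        - g.innerDual y (mvfderiv I V y).toLinearMap (mvfderiv I u y).toLinearMap) x).toLinearMap =
        (mvfderiv I (fun y ↦ g.dalembertian u y
          - g.innerDual y (mvfderiv I V y).toLinearMap (mvfderiv I u y).toLinearMap) x :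
            TangentSpace I x →ₗ[ℝ] ℝ) from rfl, h,
      MetricCoord.apply_sharpAt_comm (hGm.isInvertible _ hu0) (hGm.symm _ hu0), hLrep.fderiv_eq]
    have hΔd : DifferentiableAt ℝ (MetricCoord.lapAt G uh) (extChartAt I x x) :=
      ((hGm.contDiffOn_lapAt huh _ hu0).contDiffAt
        ((isOpen_extChartAt_target x).mem_nhds hu0)).differentiableAt (by simp)
    have hId : DifferentiableAt ℝ (fun y ↦ fderiv ℝ uh y (MetricCoord.sharpAt G y (fderiv ℝ Vh y)))
        (extChartAt I x x) := hGm.differentiableAt_innerGrad hu0 huh hVh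
    rw [fderiv_fun_sub hΔd hId]
    rfl
  -- (d) the curvature term and the Hessian term
  have hV2 : ContMDiffAt I 𝓘(ℝ, ℝ) 2 V (chartInv I x u₀) :=
    (hV.of_le (WithTop.coe_le_coe.mpr le_top)).contMDiffAt
  have hB := bakryEmery_chartInv_le g x u₀ hV2 (fun X ↦ hRic _ X)
    (MetricCoord.sharpAt G (extChartAt I x x) (fderiv ℝ uh (extChartAt I x x)))
  have hGX : G (extChartAt I x x)
      (MetricCoord.sharpAt G (extChartAt I x x) (fderiv ℝ uh (extChartAt I x x)))
      (MetricCoord.sharpAt G (extChartAt I x x) (fderiv ℝ uh (extChartAt I x x))) = g.gradSq u x := by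
    rw [MetricCoord.apply_sharpAt_sharpAt (hGm.isInvertible _ hu0), hgrad]
    rfl
  have hGY : G (extChartAt I x x)
      (MetricCoord.sharpAt G (extChartAt I x x) (fderiv ℝ ηh (extChartAt I x x)))
      (MetricCoord.sharpAt G (extChartAt I x x) (fderiv ℝ ηh (extChartAt I x x))) = g.gradSq η x := by
    rw [MetricCoord.apply_sharpAt_sharpAt (hGm.isInvertible _ hu0), hgradη]
    rfl
  have hB' : K * g.gradSq u x ≤
      MetricCoord.ricAt G (extChartAt I x x)
          (MetricCoord.sharpAt G (extChartAt I x x) (fderiv ℝ uh (extChartAt I x x)))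
          (MetricCoord.sharpAt G (extChartAt I x x) (fderiv ℝ uh (extChartAt I x x)))
        + MetricCoord.hessAt G Vh (extChartAt I x x)
          (MetricCoord.sharpAt G (extChartAt I x x) (fderiv ℝ uh (extChartAt I x x)))
          (MetricCoord.sharpAt G (extChartAt I x x) (fderiv ℝ uh (extChartAt I x x))) := by
    rw [← hGX]
    exact hB
  -- the Hessian term `N = |Hess u|²` and the slack
  set N := MetricCoord.normSqAt G (extChartAt I x x) (MetricCoord.hessAt G uh (extChartAt I x x))
    with hNdef
  have hslack : N ≤ (1 / 2) * (g.dalembertian (g.gradSq u) x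
            - g.innerDual x (mvfderiv I V x).toLinearMap (mvfderiv I (g.gradSq u) x).toLinearMap)
          - g.innerDual x (mvfderiv I u x).toLinearMap
              (mvfderiv I (fun y ↦ g.dalembertian u y
                - g.innerDual y (mvfderiv I V y).toLinearMap
                    (mvfderiv I u y).toLinearMap) x).toLinearMap
          - K * g.gradSq u x := by
    rw [hlap, hIV, hIL]
    linarith [key, hB']
  -- (e) `g⁻¹(dη, d|∇u|²) = 2 Hess u(∇η, ∇u)` and Cauchy–Schwarz
  have hpos : ∀ v : E, v ≠ 0 → 0 < G (extChartAt I x x) v v := fun v hv ↦ by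
    have h := chartPullback_pos g x u₀ (fun w hw ↦ hR _ w hw) v hv
    rwa [val_chartPullback_eq_chartRep (fun _ : ℝ ↦ g) x 0] at h
  have huhx : ContDiffAt ℝ ∞ uh (extChartAt I x x) :=
    huh.contDiffAt ((isOpen_extChartAt_target x).mem_nhds hu0)
  have hsymm : ∀ v w, MetricCoord.hessAt G uh (extChartAt I x x) v w =
      MetricCoord.hessAt G uh (extChartAt I x x) w v := fun v w ↦ hGm.hessAt_comm hu0 huhx v w
  have hCS := hGm.sq_apply_le_normSqAt_mul_mul hu0 hpos hsymm
    (MetricCoord.sharpAt G (extChartAt I x x) (fderiv ℝ ηh (extChartAt I x x)))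
    (MetricCoord.sharpAt G (extChartAt I x x) (fderiv ℝ uh (extChartAt I x x)))
  rw [hGX, hGY, ← hNdef] at hCS
  have hder : g.innerDual x (mvfderiv I η x).toLinearMap (mvfderiv I (g.gradSq u) x).toLinearMap =
      2 * MetricCoord.hessAt G uh (extChartAt I x x)
        (MetricCoord.sharpAt G (extChartAt I x x) (fderiv ℝ ηh (extChartAt I x x)))
        (MetricCoord.sharpAt G (extChartAt I x x) (fderiv ℝ uh (extChartAt I x x))) := by
    rw [hIη, hGm.fderiv_gradSqAt hu0 huh]
  have h4 : 0 ≤ 4 * g.gradSq η x * g.gradSq u x :=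
    mul_nonneg (mul_nonneg (by norm_num) (g.gradSq_nonneg hR η x)) (g.gradSq_nonneg hR u x)
  calc (g.innerDual x (mvfderiv I η x).toLinearMap (mvfderiv I (g.gradSq u) x).toLinearMap) ^ 2
      = 4 * (MetricCoord.hessAt G uh (extChartAt I x x)
          (MetricCoord.sharpAt G (extChartAt I x x) (fderiv ℝ ηh (extChartAt I x x)))
          (MetricCoord.sharpAt G (extChartAt I x x) (fderiv ℝ uh (extChartAt I x x)))) ^ 2 := by
        rw [hder]; ring
    _ ≤ 4 * (N * g.gradSq η x * g.gradSq u x) := by linarith [hCS]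
    _ = 4 * g.gradSq η x * g.gradSq u x * N := by ring
    _ ≤ _ := mul_le_mul_of_nonneg_left hslack h4

end Summit.SmoothPoincare4.SmoothPoincare4.Theorems.BakryEmeryComplete

end
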